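import Literature.NumberTheory.EllipticCurves.TakahashiDegreeFormulaFromDictionary
import Literature.NumberTheory.Automorphic.BrandtEigenLine
import Literature.NumberTheory.Automorphic.EichlerSubidealCount
import Literature.NumberTheory.EllipticCurves.NewformsMultiplicityOneProofs
import Literature.NumberTheory.EllipticCurves.HeckeOperatorsProofs
import Literature.NumberTheory.EllipticCurves.ModularSymbolsLattice
import HarnessLib

/-!
# `takahashi2001_brandtEigenLattice_rank_one` reduced to Eichler's basis theorem
# (Pizer 1980, Thm. 2.28): multiplicity one in the Brandt module from the Hecke-module isomorphism

Topic `Literature/NumberTheory/EllipticCurves`; sibling of `TakahashiDegreeFormulaFromDictionary`,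
whose named fact `takahashi2001_brandtEigenLattice_rank_one` (Takahashi 2001, p. 78: "`L_r(J)` is a
free `ℤ`-module of rank one" — asserted there without proof) is the Jacquet–Langlands / Eichler
basis-problem input of route `ABC/DefiniteXi`: for `W/ℚ` modular of square-free conductor `M r` and
a Brandt setup `S` of type `(M, r)`, the `a(W)`-eigen-lattice of the Brandt matrices has rank one.
No theorem of the tree connects Brandt matrices with cusp forms, so the fact is not discharged
here.  This file PROVES the fact from exactly one classical input, packaged as DATA:

* `BrandtJL.EichlerPizerIso S` — a `ℂ`-linear isomorphism
  `(ℂ^{Cls O})⁰ ⊕ S₂(Γ₀(M)) ⊕ S₂(Γ₀(M)) ≃ S₂(Γ₀(M r))` intertwining the Brandt matrix `T(p)` and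
  the level-`M` operators `T_p` with `T_p` of level `M r` for all primes `p ∤ M r`.  For `r`
  prime this is Pizer 1980, Thm. 2.28 (case `r = 0`, `k = 2`; Eichler 1955/1973 for square-free
  `M`): `⟨θ₁⟩ ⊕ ⋯ ⊕ ⟨θ_{H-1}⟩ ⊕ 2 S₂(M) ≅ S₂(pM)` as modules over the Hecke algebra generated by
  `T(n)`, `(n, pM) = 1`, proved there by comparing Eichler's trace formula for Brandt matrices
  with the Eichler–Selberg trace formula (Thm. 2.25).  Its EXISTENCE is not asserted in this file.
* `BrandtJL.finrank_eigenLattice_eq_one_of_eichlerPizerIso` — given such data, a parametrisation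
  datum of `W` at level `M r` (`r > 1`) and any setup `S`, the eigen-lattice has `ℤ`-rank one;
* `takahashi2001_brandtEigenLattice_rank_one_of_eichlerPizerIso` — the named fact follows from the
  existence of the data for all prime `r`, square-free `M r` and all setups.

Proof of the reduction (all inputs proved in the tree).  Let `f = P.f` (newform of level `M r`,
`a_p(f) = a_p(W)`, `T_p f = a_p f`: `heckeT_eq_cuspCoeff_smul`).  Atkin–Lehner theory
(`NewformsMultiplicityOneProofs`): the `(a_p)_{p ∤ Mr}`-eigenspace of the `T_p` is `ℂ f` in
`S₂(Γ₀(M r))` (`mem_span_of_equiv_of_mem_newSubspace0`) and `0` in `S₂(Γ₀(M))`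
(`eq_zero_of_equiv_of_mem_properDivisors`).  Complex `a(W)`-eigenvectors of the Brandt matrices are
of degree zero (`a_p(W) ≠ p + 1`, Hasse, and column sums `p + 1`, `EichlerSubidealCount`), so they
live in the source of `Φ` and are mapped into `ℂ f`; conversely `Φ⁻¹ f` is a non-zero eigenvector.
Hence the complex eigenspace is a line; a `ℚ`-linear retraction `ℂ → ℚ` and clearing denominators
give a non-zero integral eigenvector, two integral eigenvectors are proportional, and
`Brandt.exists_eigenLattice_eq_span` makes the eigen-lattice a line `ℤ φ`.  No dimension theory
of base change is used.

## References

* [Pizer1980] A. Pizer, An algorithm for computing modular forms on `Γ₀(N)`, J. Algebra 64 (1980)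
  340–390: Def. 2.13, (2.6), Lemma 2.18–2.19, Prop. 2.22–2.23, Thm. 2.25, Thm. 2.28, Cor. 2.29
  (held: `paper:doi-10-1016-0021-8693-80-90151-9`, pp. 353–360 read).
* [Eichler1973] M. Eichler, The basis problem for modular forms and the traces of the Hecke
  operators, LNM 320 (1973), Ch. II §6, Ch. IV.
* [Takahashi2001] S. Takahashi, J. Number Theory 90 (2001), §2 p. 78.
* [AtkinLehner1970] A. O. L. Atkin, J. Lehner, Math. Ann. 185 (1970), Thm. 3, Thm. 5.
-/

noncomputable section

open scoped BigOperators Matrix MatrixGroups ModularForm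
open CongruenceSubgroup UpperHalfPlane

namespace Literature.NumberTheory.EllipticCurves

open Literature.NumberTheory.Automorphic Literature.NumberTheory.Automorphic.Brandt
open Literature.NumberTheory.EllipticCurves.ModularForms

namespace BrandtJL

variable {ι : Type*} [Fintype ι]

/-- The **degree-zero part** `(K^ι)⁰ = {v : Σ_i v_i = 0}` of `K^ι`. [folklore] -/
def degreeZero (K : Type*) [Field K] (ι : Type*) [Fintype ι] : Submodule K (ι → K) where
  carrier := {v | ∑ i, v i = 0}
  add_mem' {v w} hv hw := by
    simp only [Set.mem_setOf_eq, Pi.add_apply] at *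
    rw [Finset.sum_add_distrib, hv, hw, add_zero]
  zero_mem' := by simp
  smul_mem' c {v} hv := by
    simp only [Set.mem_setOf_eq, Pi.smul_apply, smul_eq_mul] at *
    rw [← Finset.mul_sum, hv, mul_zero]

/-- Membership in the degree-zero part (definitional). [folklore] -/
theorem mem_degreeZero_iff {K : Type*} [Field K] {v : ι → K} :
    v ∈ degreeZero K ι ↔ ∑ i, v i = 0 :=
  Iff.rfl

variable {Nplus Nminus : ℕ}

/-- Column sums of the complexified Brandt matrix `T(p)`, `p ∤ N⁺N⁻` prime: `p + 1`. [folklore] -/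
theorem sum_matrix_map_prime_eq (S : XiSetup Nplus Nminus) [Fintype (ClassSet S.O)]
    {p : ℕ} (hp : p.Prime) (hpN : ¬ p ∣ Nplus * Nminus) (j : ClassSet S.O) :
    ∑ i, ((Brandt.matrix S.O p).map (Int.castRingHom ℂ)) i j = (p : ℂ) + 1 := by
  have h := congrArg (Int.cast : ℤ → ℂ) (S.sum_matrix_prime_eq hp hpN j)
  push_cast at h
  simpa [Matrix.map_apply] using h

/-- The complexified Brandt matrix `T(p)`, `p ∤ N⁺N⁻` prime, preserves the degree-zero part. [folklore] -/
theorem mulVec_mem_degreeZero (S : XiSetup Nplus Nminus) [Fintype (ClassSet S.O)]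
    {p : ℕ} (hp : p.Prime) (hpN : ¬ p ∣ Nplus * Nminus) {v : ClassSet S.O → ℂ}
    (hv : v ∈ degreeZero ℂ (ClassSet S.O)) :
    ((Brandt.matrix S.O p).map (Int.castRingHom ℂ)) *ᵥ v ∈ degreeZero ℂ (ClassSet S.O) := by
  rw [mem_degreeZero_iff] at hv ⊢
  rw [sum_mulVec_eq_mul_sum _ (sum_matrix_map_prime_eq S hp hpN), hv, mul_zero]

/-- The Hecke operator `T(p)` (`p ∤ N⁺N⁻` prime) on the degree-zero part of the complex Brandt
module `ℂ^{Cls O}`: `Matrix.mulVec` of the Brandt matrix, restricted. [folklore] -/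
def heckeOp (S : XiSetup Nplus Nminus) [Fintype (ClassSet S.O)] {p : ℕ}
    (hp : p.Prime) (hpN : ¬ p ∣ Nplus * Nminus) :
    degreeZero ℂ (ClassSet S.O) →ₗ[ℂ] degreeZero ℂ (ClassSet S.O) :=
  (Matrix.mulVecLin ((Brandt.matrix S.O p).map (Int.castRingHom ℂ))).restrict fun v hv => by
    simpa only [Matrix.mulVecLin_apply] using mulVec_mem_degreeZero S hp hpN hv

/-- `heckeOp` is `T(p) v` on coordinates. [folklore] -/
@[simp] theorem coe_heckeOp (S : XiSetup Nplus Nminus) [Fintype (ClassSet S.O)]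
    {p : ℕ} (hp : p.Prime) (hpN : ¬ p ∣ Nplus * Nminus) (v : degreeZero ℂ (ClassSet S.O)) :
    ((heckeOp S hp hpN v : degreeZero ℂ (ClassSet S.O)) : ClassSet S.O → ℂ) =
      ((Brandt.matrix S.O p).map (Int.castRingHom ℂ)) *ᵥ (v : ClassSet S.O → ℂ) := by
  simp [heckeOp]

/-- Eigenvectors for `a(E)` are degree zero (complex version). [folklore] -/
theorem mem_degreeZero_of_mem_eigenSpace (S : XiSetup Nplus Nminus)
    [Fintype (ClassSet S.O)] (W : WeierstrassCurve ℚ) [W.IsElliptic] {v : ClassSet S.O → ℂ}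
    (hv : v ∈ eigenSpace ℂ (Nplus * Nminus) (Brandt.matrix S.O) fun n => W.LFunction n) :
    v ∈ degreeZero ℂ (ClassSet S.O) := by
  have hN : Nplus * Nminus ≠ 0 := mul_ne_zero S.nplus_ne_zero S.squarefree.ne_zero
  obtain ⟨p, hpgt, hp⟩ := Nat.exists_infinite_primes (Nplus * Nminus + 1)
  have hpN : ¬ p ∣ Nplus * Nminus := fun h => by
    have := Nat.le_of_dvd (Nat.pos_of_ne_zero hN) h
    omega
  have hne : ((W.LFunction p : ℤ) : ℂ) ≠ (p : ℂ) + 1 := by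
    exact_mod_cast W.lFunction_ne_prime_add_one hp
  exact sum_eq_zero_of_mulVec_eq_smul _ (sum_matrix_map_prime_eq S hp hpN) (hv p hp hpN) hne

/-- A non-zero complex common eigenvector forces a non-zero eigen-lattice. [folklore] -/
theorem eigenLattice_ne_bot_of_mem_eigenSpace {N : ℕ} {T : ℕ → Matrix ι ι ℤ} {lam : ℕ → ℤ}
    {v : ι → ℂ} (hv : v ∈ eigenSpace ℂ N T lam) (hv0 : v ≠ 0) : eigenLattice N T lam ≠ ⊥ := by
  classical
  obtain ⟨g, hg⟩ := LinearMap.exists_leftInverse_of_injective (Algebra.linearMap ℚ ℂ) (by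
    rw [LinearMap.ker_eq_bot]; exact (algebraMap ℚ ℂ).injective)
  have hg1 : g 1 = 1 := by simpa using LinearMap.congr_fun hg 1
  obtain ⟨i₀, hi₀⟩ : ∃ i, v i ≠ 0 := by by_contra h; push Not at h; exact hv0 (funext h)
  set v' : ι → ℂ := (v i₀)⁻¹ • v with hv'
  have hv'mem : v' ∈ eigenSpace ℂ N T lam := Submodule.smul_mem _ _ hv
  have hv'i₀ : v' i₀ = 1 := by simp [hv', inv_mul_cancel₀ hi₀]
  set w : ι → ℚ := fun i => g (v' i) with hw
  have hw0 : w ≠ 0 := fun h => by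
    have := congrFun h i₀
    simp [hw, hv'i₀, hg1] at this
  have hwmem : w ∈ eigenSpace ℚ N T lam := by
    intro p hp hpN
    have h := hv'mem p hp hpN
    funext i
    have hi := congrFun h i
    simp only [Matrix.mulVec, dotProduct, Matrix.map_apply, eq_intCast, Pi.smul_apply,
      smul_eq_mul] at hi ⊢
    have key := congrArg g hi
    rw [map_sum] at key
    simp_rw [← zsmul_eq_mul, map_zsmul, zsmul_eq_mul] at key
    exact_mod_cast key
  obtain ⟨D, hD, z, hz⟩ := exists_nat_smul_eq_intCast w
  have hzmem : z ∈ eigenLattice N T lam := by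
    rw [← intCast_mem_eigenSpace_iff (K := ℚ), hz]
    exact Submodule.smul_mem _ _ hwmem
  have hz0 : z ≠ 0 := by
    intro h0
    rw [h0] at hz
    have hzero : (D : ℚ) • w = 0 := by rw [← hz]; funext i; simp
    rcases smul_eq_zero.mp hzero with hD' | hw'
    · exact hD (by exact_mod_cast hD')
    · exact hw0 hw'
  exact fun hbot => hz0 ((Submodule.mem_bot ℤ).mp (hbot ▸ hzmem))

/-- A complex proportionality between integer vectors is an integral one. [folklore] -/
theorem exists_int_smul_eq_of_complex {v w : ι → ℤ} {c : ℂ}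
    (h : (fun i => (w i : ℂ)) = c • fun i => (v i : ℂ)) :
    ∃ a b : ℤ, (a ≠ 0 ∨ b ≠ 0) ∧ a • v = b • w := by
  by_cases hv : v = 0
  · exact ⟨1, 0, Or.inl one_ne_zero, by rw [hv, smul_zero, zero_smul]⟩
  · obtain ⟨i₀, hi₀⟩ : ∃ i, v i ≠ 0 := by by_contra h'; push Not at h'; exact hv (funext h')
    refine ⟨w i₀, v i₀, Or.inr hi₀, funext fun j => ?_⟩
    have hj := congrFun h j
    have hi := congrFun h i₀
    simp only [Pi.smul_apply, smul_eq_mul] at hj hi ⊢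
    have : (w i₀ : ℂ) * v j = (v i₀ : ℂ) * w j := by rw [hi, hj]; ring
    exact_mod_cast this

/-! ### Modular side -/

variable {N : ℕ} [NeZero N] {k : ℤ}

/-- For a newform `f` and a prime `p`, `T_p f = a_p(f) f` with `a_p(f)` the `p`-th Fourier
coefficient (Atkin–Lehner 1970, Thm. 3; compare `a₁` in `T_p f = λ f`). [cite: AtkinLehner1970, Thm. 3] -/
theorem heckeT_eq_cuspCoeff_smul {f : CuspForm (Gamma0 N) k} (hf : IsNewform0 f) {p : ℕ}
    (hp : p.Prime) :
    (haveI : NeZero p := ⟨hp.ne_zero⟩; heckeT (Gamma0 N) k p f) = cuspCoeff f p • f := by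
  haveI : NeZero p := ⟨hp.ne_zero⟩
  have heig := heckeT_eq_heckeEigenvalue_smul f p (hf.2.1 p hp)
  have h1 := qExpansion_coeff_heckeT_holds N k f p hp 1
  have hcoe : ⇑(heckeT (Gamma0 N) k p f) = heckeEigenvalue f p • ⇑f := by rw [heig]; rfl
  have hnorm : (qExpansion 1 ⇑f).coeff 1 = 1 := hf.2.2
  rw [hcoe, ModularForm.qExpansion_smul one_pos (one_mem_strictPeriods_gamma0 N) _ f, map_smul,
    smul_eq_mul, hnorm, mul_one, mul_one, if_neg (Nat.Prime.not_dvd_one hp), mul_zero,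
    ite_self, add_zero] at h1
  rw [heig, h1]
  rfl

/-! ### The Eichler–Pizer isomorphism data and the reduction -/

/-- **Eichler's basis theorem in Pizer's Hecke-module form — as DATA (a hypothesis structure).**
For a Brandt setup `S` of type `(M, r)` (definite quaternion algebra over `ℚ` of discriminant
`r`, Eichler order `O` of level `M`): a `ℂ`-linear isomorphism
`Φ : (ℂ^{Cls O})⁰ ⊕ S₂(Γ₀(M)) ⊕ S₂(Γ₀(M)) ≃ S₂(Γ₀(M r))`
intertwining, for every prime `p ∤ M r`, the Brandt matrix `T(p)` (`Matrix.mulVec` of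
`Brandt.matrix S.O p` on the degree-zero part `(ℂ^{Cls O})⁰`, `heckeOp`) and `T_p` of level `M` on
the two copies of `S₂(Γ₀(M))` with `T_p` of level `M r`.  For `r = p` PRIME this is Pizer 1980,
Thm. 2.28, case `r = 0`, `k = 2` (an order of level `p M`, `p ∤ M`, in the quaternion algebra
ramified precisely at `p` and `∞`): *"`⟨θ₁(τ)⟩ ⊕ ⋯ ⊕ ⟨θ_d(τ)⟩ ⊕ 2 S₂(M) ≅ S₂(pM)` (`d = H - 1`)
as modules for the Hecke algebra generated by `T(n)`, `(n, N) = 1`"*, where `T(n)` acts on the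
theta series `θ_i` through the modified Brandt matrices `B'(n)` (loc. cit. (2.6), Lemma 2.19,
Prop. 2.22–2.23), i.e. through `B(n)` on the complement of the Eisenstein vector — Eichler 1955 /
1973 for square-free `M` ("basis problem"), proved by comparing the Eichler–Selberg trace
formula with Eichler's trace formula for Brandt matrices (loc. cit. Thm. 2.25).  The tree's
`Brandt.matrix` is Voight's `T(n)` (transpose convention and right ideal classes, see
`BrandtXi.lean`); as Hecke modules over `ℂ` this is isomorphic to Pizer's (weight symmetry
`w_i T_ij = w_j T_ji` and semisimplicity).  NOTHING here asserts that such data exist: existence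
for prime `r` is exactly the Jacquet–Langlands / Eichler input which the tree does not prove
(and which is false for composite `r`, where the `r`-old part of `S₂(Γ₀(M r))` is larger). [cite: Pizer1980, Thm. 2.28 (case r = 0, k = 2), with (2.6), Lemma 2.19, Prop. 2.22–2.23] -/
structure EichlerPizerIso {M r : ℕ} [NeZero M] [NeZero (M * r)] (S : XiSetup M r)
    [Fintype (ClassSet S.O)] where
  /-- The Hecke-module isomorphism `(ℂ^{Cls O})⁰ ⊕ S₂(Γ₀(M))² ≃ S₂(Γ₀(M r))`. -/
  Φ : (degreeZero ℂ (ClassSet S.O) × (CuspForm (Gamma0 M) 2 × CuspForm (Gamma0 M) 2)) ≃ₗ[ℂ]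
    CuspForm (Gamma0 (M * r)) 2
  /-- `Φ` intertwines `T(p) ⊕ T_p ⊕ T_p` with `T_p`, for every prime `p ∤ M r`. -/
  map_hecke : ∀ (p : ℕ) (hp : p.Prime) (hpN : ¬ p ∣ M * r)
    (x : degreeZero ℂ (ClassSet S.O) × (CuspForm (Gamma0 M) 2 × CuspForm (Gamma0 M) 2)),
    Φ (heckeOp S hp hpN x.1,
        (haveI : NeZero p := ⟨hp.ne_zero⟩; heckeT (Gamma0 M) 2 p x.2.1),
        (haveI : NeZero p := ⟨hp.ne_zero⟩; heckeT (Gamma0 M) 2 p x.2.2)) =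
      (haveI : NeZero p := ⟨hp.ne_zero⟩; heckeT (Gamma0 (M * r)) 2 p (Φ x))

/-- **Multiplicity one on the quaternion side from the Eichler–Pizer isomorphism.**  Let `W/ℚ` be
elliptic with a modular parametrisation datum `P` at level `M r` (`r > 1`; so `f = P.f` is a
newform of level `M r` with `a_p(f) = a_p(W)`), `S` a Brandt setup of type `(M, r)` and `E` an
Eichler–Pizer isomorphism for `S`.  Then the `a(W)`-eigen-lattice of the Brandt matrices `T(p)`,
`p ∤ M r`, in `ℤ^{Cls O}` has `ℤ`-rank one (proof in the module docstring: Atkin–Lehner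
multiplicity one at levels `M r` and `M`, transport through `Φ`, descent `ℂ → ℚ → ℤ`).
[cite: Pizer1980, Thm. 2.28 (case r = 0, k = 2)] -/
theorem finrank_eigenLattice_eq_one_of_eichlerPizerIso
    (W : WeierstrassCurve ℚ) [W.IsElliptic] (M r : ℕ) [NeZero M] [NeZero (M * r)]
    (hr : 1 < r) (P : ModularParametrizationData W (M * r))
    (S : XiSetup M r) [Fintype (ClassSet S.O)] (E : EichlerPizerIso S) :
    Module.finrank ℤ (eigenLattice (M * r) (Brandt.matrix S.O) fun n => W.LFunction n) = 1 := by
  classical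
  set f := P.f with hf_def
  have hf : IsNewform0 f := P.isNewformOf.1
  have hcoef : ∀ n, cuspCoeff f n = (W.LFunction n : ℂ) := P.isNewformOf.2
  set a : ℕ → ℂ := fun n => ((W.LFunction n : ℤ) : ℂ) with ha
  have hfT : ∀ (p : ℕ) (hp : p.Prime), ¬ p ∣ M * r →
      (haveI : NeZero p := ⟨hp.ne_zero⟩; heckeT (Gamma0 (M * r)) 2 p f) = a p • f := by
    intro p hp _
    rw [heckeT_eq_cuspCoeff_smul hf hp, hcoef]
  have hf0 : f ≠ 0 := hf.ne_zero
  have hfnew : f ∈ newSubspace0 (M * r) 2 := hf.1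
  -- (1) no form of level `M` has the eigenvalues of `f`
  have hMdiv : M ∈ (M * r).properDivisors := by
    rw [Nat.mem_properDivisors]
    exact ⟨dvd_mul_right M r, lt_mul_of_one_lt_right (Nat.pos_of_ne_zero (NeZero.ne M)) hr⟩
  have hE0 : ∀ g : CuspForm (Gamma0 M) 2, (∀ (p : ℕ) (hp : p.Prime), ¬ p ∣ M * r →
      (haveI : NeZero p := ⟨hp.ne_zero⟩; heckeT (Gamma0 M) 2 p g) = a p • g) → g = 0 :=
    fun g hg => eq_zero_of_equiv_of_mem_properDivisors hf0 hfnew hfT M hMdiv g hg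
  -- (2) at level `M r` the eigenspace is `ℂ f`
  have hE1 : ∀ g : CuspForm (Gamma0 (M * r)) 2, (∀ (p : ℕ) (hp : p.Prime), ¬ p ∣ M * r →
      (haveI : NeZero p := ⟨hp.ne_zero⟩; heckeT (Gamma0 (M * r)) 2 p g) = a p • g) →
      g ∈ Submodule.span ℂ ({f} : Set (CuspForm (Gamma0 (M * r)) 2)) :=
    fun g hg => mem_span_of_equiv_of_mem_newSubspace0 hf0 hfnew hfT g hg
  set Φ := E.Φ with hΦ_def
  have hΦ := E.map_hecke
  set L := eigenLattice (M * r) (Brandt.matrix S.O) fun n => W.LFunction n with hL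
  set J := eigenSpace ℂ (M * r) (Brandt.matrix S.O) fun n => W.LFunction n with hJ
  -- (3) complex Brandt eigenvectors go to `ℂ f`
  have hJΦ : ∀ (v : ClassSet S.O → ℂ) (hv : v ∈ J),
      Φ (⟨v, mem_degreeZero_of_mem_eigenSpace S W hv⟩, 0, 0) ∈
        Submodule.span ℂ ({f} : Set (CuspForm (Gamma0 (M * r)) 2)) := by
    intro v hv
    apply hE1
    intro p hp hpN
    haveI : NeZero p := ⟨hp.ne_zero⟩
    have key := hΦ p hp hpN (⟨v, mem_degreeZero_of_mem_eigenSpace S W hv⟩, 0, 0)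
    simp only [map_zero] at key
    have hBv : heckeOp S hp hpN ⟨v, mem_degreeZero_of_mem_eigenSpace S W hv⟩ =
        a p • ⟨v, mem_degreeZero_of_mem_eigenSpace S W hv⟩ := by
      apply Subtype.ext
      rw [coe_heckeOp]
      exact hv p hp hpN
    rw [hBv] at key
    have hsm : ((a p • (⟨v, mem_degreeZero_of_mem_eigenSpace S W hv⟩ : degreeZero ℂ (ClassSet S.O)),
        (0 : CuspForm (Gamma0 M) 2), (0 : CuspForm (Gamma0 M) 2)) :
          degreeZero ℂ (ClassSet S.O) × (CuspForm (Gamma0 M) 2 × CuspForm (Gamma0 M) 2)) =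
        a p • (⟨v, mem_degreeZero_of_mem_eigenSpace S W hv⟩, 0, 0) := by
      simp
    rw [hsm, map_smul] at key
    exact key.symm
  -- (4) `L ≠ ⊥`: pull `f` back
  have hne : L ≠ ⊥ := by
    set x := Φ.symm f with hx
    have hxT : ∀ (p : ℕ) (hp : p.Prime) (hpN : ¬ p ∣ M * r),
        ((heckeOp S hp hpN x.1,
          (haveI : NeZero p := ⟨hp.ne_zero⟩; heckeT (Gamma0 M) 2 p x.2.1),
          (haveI : NeZero p := ⟨hp.ne_zero⟩; heckeT (Gamma0 M) 2 p x.2.2)) :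
            degreeZero ℂ (ClassSet S.O) × (CuspForm (Gamma0 M) 2 × CuspForm (Gamma0 M) 2))
          = a p • x := by
      intro p hp hpN
      haveI : NeZero p := ⟨hp.ne_zero⟩
      apply Φ.injective
      rw [hΦ p hp hpN x, map_smul, hx, LinearEquiv.apply_symm_apply, hfT p hp hpN]
    have hx21 : x.2.1 = 0 := hE0 _ fun p hp hpN => by
      have := congrArg (fun y => y.2.1) (hxT p hp hpN)
      simpa using this
    have hx22 : x.2.2 = 0 := hE0 _ fun p hp hpN => by
      have := congrArg (fun y => y.2.2) (hxT p hp hpN)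
      simpa using this
    have hx1mem : ((x.1 : degreeZero ℂ (ClassSet S.O)) : ClassSet S.O → ℂ) ∈ J := by
      intro p hp hpN
      have := congrArg (fun y => ((y.1 : degreeZero ℂ (ClassSet S.O)) : ClassSet S.O → ℂ))
        (hxT p hp hpN)
      simpa using this
    have hx1ne : ((x.1 : degreeZero ℂ (ClassSet S.O)) : ClassSet S.O → ℂ) ≠ 0 := by
      intro h0
      have hx1 : x.1 = 0 := Subtype.ext h0
      have hx0 : x = 0 := Prod.ext hx1 (Prod.ext hx21 hx22)
      apply hf0
      rw [← LinearEquiv.apply_symm_apply Φ f, ← hx, hx0, map_zero]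
    exact eigenLattice_ne_bot_of_mem_eigenSpace hx1mem hx1ne
  -- (5) any two integral eigenvectors are proportional
  have hdep : ∀ v ∈ L, ∀ w ∈ L, ∃ c d : ℤ, (c ≠ 0 ∨ d ≠ 0) ∧ c • v = d • w := by
    intro v hv w hw
    have hvJ : (fun i => (v i : ℂ)) ∈ J := intCast_mem_eigenSpace_iff.mpr hv
    have hwJ : (fun i => (w i : ℂ)) ∈ J := intCast_mem_eigenSpace_iff.mpr hw
    obtain ⟨α, hα⟩ := Submodule.mem_span_singleton.mp (hJΦ _ hvJ)
    obtain ⟨β, hβ⟩ := Submodule.mem_span_singleton.mp (hJΦ _ hwJ)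
    by_cases hα0 : α = 0
    · refine ⟨1, 0, Or.inl one_ne_zero, ?_⟩
      rw [hα0, zero_smul] at hα
      have h0 := Φ.injective (hα.symm.trans (map_zero Φ).symm)
      have hv0 : (fun i => (v i : ℂ)) = 0 := by
        have := congrArg (fun y => ((y.1 : degreeZero ℂ (ClassSet S.O)) : ClassSet S.O → ℂ)) h0
        simpa using this
      rw [one_smul, zero_smul]
      funext i
      have := congrFun hv0 i
      simp only [Pi.zero_apply] at this
      rw [Pi.zero_apply]
      exact_mod_cast this
    · have hprop : ((⟨fun i => (w i : ℂ), mem_degreeZero_of_mem_eigenSpace S W hwJ⟩,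
          (0 : CuspForm (Gamma0 M) 2), (0 : CuspForm (Gamma0 M) 2)) :
            degreeZero ℂ (ClassSet S.O) × (CuspForm (Gamma0 M) 2 × CuspForm (Gamma0 M) 2)) =
          (β / α) • (⟨fun i => (v i : ℂ), mem_degreeZero_of_mem_eigenSpace S W hvJ⟩, 0, 0) := by
        apply Φ.injective
        rw [map_smul, ← hα, ← hβ, smul_smul, div_mul_cancel₀ β hα0]
      have hcoe : (fun i => (w i : ℂ)) = (β / α) • fun i => (v i : ℂ) := by
        have := congrArg (fun y => ((y.1 : degreeZero ℂ (ClassSet S.O)) : ClassSet S.O → ℂ))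
          hprop
        simpa using this
      exact exists_int_smul_eq_of_complex hcoe
  -- (6) conclude
  obtain ⟨φ, hφ, hLφ⟩ := exists_eigenLattice_eq_span hne hdep
  rw [show L = ℤ ∙ φ from hLφ,
    ← (LinearEquiv.toSpanNonzeroSingleton ℤ (ClassSet S.O → ℤ) φ hφ).finrank_eq, Module.finrank_self]

end BrandtJL

open BrandtJL in
/-- **`takahashi2001_brandtEigenLattice_rank_one` from Eichler's basis theorem (Pizer's form).**
If for every prime `r`, every `M` with `M r` square-free and every Brandt setup `S` of type
`(M, r)` the Eichler–Pizer Hecke-module isomorphism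
`(ℂ^{Cls O})⁰ ⊕ S₂(Γ₀(M))² ≅ S₂(Γ₀(M r))` exists (Pizer 1980 Thm. 2.28, `r = 0`, `k = 2`;
Eichler's basis problem / the Jacquet–Langlands correspondence with multiplicities), then the
named fact `takahashi2001_brandtEigenLattice_rank_one` ("`L_r(J)` is free of rank one",
Takahashi 2001 p. 78) holds.  This isolates exactly the unproved input. [cite: Pizer1980, Thm. 2.28 (case r = 0, k = 2)] -/
theorem takahashi2001_brandtEigenLattice_rank_one_of_eichlerPizerIso
    (h : ∀ (M r : ℕ) [NeZero M] [NeZero (M * r)], r.Prime → Squarefree (M * r) →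
      ∀ (S : XiSetup M r) [Fintype (ClassSet S.O)], Nonempty (EichlerPizerIso S)) :
    takahashi2001_brandtEigenLattice_rank_one := by
  intro W _ M r _ hr hsq _hN P S _
  haveI : NeZero M := ⟨fun h0 => NeZero.ne (M * r) (by rw [h0, zero_mul])⟩
  obtain ⟨E⟩ := h M r hr hsq S
  exact finrank_eigenLattice_eq_one_of_eichlerPizerIso W M r hr.one_lt P S E

end Literature.NumberTheory.EllipticCurves

end
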